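import Summits.CriticalPhenomena.PercolationContinuityZ3.Theorems.Transplant.PlanarSkeletonFrmQuasiDefs
import Summits.CriticalPhenomena.PercolationContinuityZ3.Theorems.Transplant.SkelFrmQuasiBChoiceGeomT
import Summits.CriticalPhenomena.PercolationContinuityZ3.Theorems.Transplant.SkelFrmBChoiceGeomT
import Summits.CriticalPhenomena.PercolationContinuityZ3.Theorems.Transplant.SkelFrmQuasiBParamsSchedAT
import Summits.CriticalPhenomena.PercolationContinuityZ3.Theorems.Transplant.SkelFrmBParamsSchedAT
import Summits.CriticalPhenomena.PercolationContinuityZ3.Theorems.Transplant.PlanarCells2LevelsT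
import Summits.CriticalPhenomena.PercolationContinuityZ3.Theorems.Transplant.SkelFrmFromBChoiceRooms
import Summits.CriticalPhenomena.PercolationContinuityZ3.Theorems.Transplant.SkelFrmBChoiceRooms
import HarnessLib
import Summits.CriticalPhenomena.PercolationContinuityZ3.Theorems.Transplant.SkelFrmBChoiceRoomsT
/-!
# GEN-Q PORT (WAVE-Q table v0.8 section 2, row G070, U-level L11; captain R-6/R-7 2026-08-27: carrier token swap `PlanarSkeletonFrmFrom ↦ PlanarSkeletonFrmQuasi`)
# of the tree module «Transplant/SkelFrmFromBChoiceRoomsT» (sha256 9d1734371a31aae4…) onto the quasi-step carrier `PlanarSkeletonFrmQuasi` (p507026): «SkelFrmQuasiBChoiceRoomsT»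

HAND HUNKS (captain R-16 (a), this seat): the column-vertex family `colVT/colVT_spec/colVT_eq/colVT_mem_graphBall/colVT_mem_graphBall_lin` takes `(hq : Skelφ.QStepsN G φ' Φ.M)` in place of `(hstep : Skelφ.Steps G φ')` — cost PINNED to `Φ.M` (not a free `M`) because `colVT` is chosen from `hcol_fineA_atT … y (le_refl (offNT … y))` and p3-g30's `offNT y := Φ.M·NrepA (cenS y) + 1` (G048); the only producer is `qStepsN_φL : QStepsN G (φL …) Φ.M` (G026). `colVT_mem_graphBall_lin`: radius `cOffS·‖y‖₁ + 1 ↦ Φ.M·cOffS·‖y‖₁ + 1` (via p3's `offNT_le`, G064) — the K-2 readers' `D₀` (my G250/G251 `hRD`).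

ORIGINAL TITLE: (R-40) `…T` TWIN (stmt-g21, 2026-08-23; ruling p3-g16 06:23:56Z, J18; lead g11 06:35:07Z: the choice function of record moves to `frmChoiceAllQ3T`): the twin of

builds on p205010 (kernel theorem, internal audit signed; external expert review pending) — nothing in this file uses p205010; NOTHING is claimed about any open node
((N3-b), the end state).  Lane `prim-bschramm`, seat `prim-bschramm-stmt` (gen 33; GEN-Q column pen; tool = captain gen-1 g4's port_genq.py R-14 --cone + p3-g30's T1 patch).  Helper file (`--supports stmt-CriticalPhenomena-4575 --as helper`).
PORT RULES (U-wave r1–r4 re-used, GEN-Q hunk classes of p3-g29 #6136): declaration order, names and proof texts are those of «SkelFrmFromBChoiceRoomsT», byte-identical except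
(i) the carrier token `PlanarSkeletonFrmFrom ↦ PlanarSkeletonFrmQuasi` in binders, `namespace`/`end` lines and qualified names (module names `SkelFrmFrom… ↦ SkelFrmQuasi…`
in imports of already-ported rows); (ii) `Φ.step ↦ Φ.qstep` with the called Steps lemma replaced by its `…Q`/`_q` twin and the cost `Φ.M` threaded (none in this file unless
listed below); (iii) `Φ.cyl_connected ↦ Φ.cyl_reach` readers (none unless listed); (iv) graph-ball radii / window floors ×`Φ.M` (none unless listed).  Carrier-free
residents stay imported/exported from the original «SkelFrmBChoiceRoomsT» exactly as in the FrmFrom port.  Docstrings and citations are the original's.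

-/

noncomputable section

open scoped Classical

namespace Summit.CriticalPhenomena.PercolationContinuityZ3.Theorems.Transplant

open Literature.Probability.Percolation Literature.Probability.LatticeModels SimpleGraph KNCells
open Literature.Barriers.CriticalPhenomena (graphBall graphBall_mono)
open BoxProdZ2 (ConcRadiiG)

/-! ## §1 The world rows over `cellGeomSG₂bT` (generic) -/

namespace Skelφ

section World

variable {V : Type} [DecidableEq V] {G : SimpleGraph V} [G.LocallyFinite] {ψ : V → Site 2} {P : PCells2T} {w₀ : V} {Λ : ConcRadiiG} {b₀ : Fin 2 → ℕ}

end World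

end Skelφ

/-! ## §2 The column vertex over the staggered centre (the (ζ″) cells, map slot `φ′`) -/

namespace PlanarSkeletonFrmQuasi

namespace NegB

open SkelConc (Consts)
open Neg

section Col

variable (κ : Consts) {V : Type} [DecidableEq V] [Countable V] {G : SimpleGraph V} [G.LocallyFinite] (Φ : PlanarSkeletonFrmQuasi G) (t : V)
  (p : unitInterval) (D : Skelφ.StepI.DataNS V) (g f : ℕ) (c : Fin 2 → ℕ) {φ' : V → Site 2}

/-- **THE COLUMN VERTEX OVER THE STAGGERED CENTRE**: a vertex of fine position exactly `cenS y`, inside the cube window of radius `offNT y = Φ.M·NrepA (cenS y) + 1` (quasi-step cost `Φ.M`; p3-g30's G048) (chosen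
from `hcol_fineA_atT`). [cite: KozmaNitzan2024, §4 p. 26 ((29): columns)] -/
def colVT (κ : Consts) {V : Type} [DecidableEq V] [Countable V] {G : SimpleGraph V} [G.LocallyFinite] (Φ : PlanarSkeletonFrmQuasi G) (t : V) (p : unitInterval) (D : Skelφ.StepI.DataNS V) (g : ℕ) (f : ℕ) (c : Fin 2 → ℕ) {φ' : V → Site 2} (hlip : Skelφ.Lip G φ') (hq : Skelφ.QStepsN G φ' Φ.M) (hN : EqNumL κ Φ t p D g f) (y : Site 2) : V :=
  Classical.choose (hcol_fineA_atT κ Φ t p D g f c hlip hq hN y (le_refl (offNT κ Φ t p D g f c y)))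

/-- The column vertex's defining facts. [folklore] -/
theorem colVT_spec (κ : Consts) {V : Type} [DecidableEq V] [Countable V] {G : SimpleGraph V} [G.LocallyFinite] (Φ : PlanarSkeletonFrmQuasi G) (t : V) (p : unitInterval) (D : Skelφ.StepI.DataNS V) (g : ℕ) (f : ℕ) (c : Fin 2 → ℕ) {φ' : V → Site 2} (hlip : Skelφ.Lip G φ') (hq : Skelφ.QStepsN G φ' Φ.M) (hN : EqNumL κ Φ t p D g f) (y : Site 2) :
    colVT κ Φ t p D g f c hlip hq hN y ∈ Skelφ.VWin G (fineA κ Φ t p D g f φ') t ((fcellsT κ Φ t p D g f c).Q y) (offNT κ Φ t p D g f c y) ∧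
      fineA κ Φ t p D g f φ' (colVT κ Φ t p D g f c hlip hq hN y) = (fcellsT κ Φ t p D g f c).cenS y :=
  (Classical.choose_spec (hcol_fineA_atT κ Φ t p D g f c hlip hq hN y (le_refl (offNT κ Φ t p D g f c y))))

/-- **`fineA (colVT y) = cenS y`** (the (C)/(R) binder `hcF`). [folklore] -/
theorem colVT_eq (κ : Consts) {V : Type} [DecidableEq V] [Countable V] {G : SimpleGraph V} [G.LocallyFinite] (Φ : PlanarSkeletonFrmQuasi G) (t : V) (p : unitInterval) (D : Skelφ.StepI.DataNS V) (g : ℕ) (f : ℕ) (c : Fin 2 → ℕ) {φ' : V → Site 2} (hlip : Skelφ.Lip G φ') (hq : Skelφ.QStepsN G φ' Φ.M) (hN : EqNumL κ Φ t p D g f) (y : Site 2) :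
    fineA κ Φ t p D g f φ' (colVT κ Φ t p D g f c hlip hq hN y) = (fcellsT κ Φ t p D g f c).cenS y :=
  (colVT_spec κ Φ t p D g f c hlip hq hN y).2

-- GEN-Q (R-2, captain 2026-08-27): `PlanarSkeletonFrmFrom.NegB.colVT_mem_VWin` is not in the used cone of the node top — not ported.

-- GEN-Q (R-2, captain 2026-08-27): `PlanarSkeletonFrmFrom.NegB.colVT_mem_VWin_schedOfT` is not in the used cone of the node top — not ported.

/-- **The column vertex's depth** `colVT y ∈ B_G(t, offNT y)`. [folklore] -/
theorem colVT_mem_graphBall (κ : Consts) {V : Type} [DecidableEq V] [Countable V] {G : SimpleGraph V} [G.LocallyFinite] (Φ : PlanarSkeletonFrmQuasi G) (t : V) (p : unitInterval) (D : Skelφ.StepI.DataNS V) (g : ℕ) (f : ℕ) (c : Fin 2 → ℕ) {φ' : V → Site 2} (hlip : Skelφ.Lip G φ') (hq : Skelφ.QStepsN G φ' Φ.M) (hN : EqNumL κ Φ t p D g f) (y : Site 2) :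
    colVT κ Φ t p D g f c hlip hq hN y ∈ graphBall G t (offNT κ Φ t p D g f c y) :=
  Skelφ.mem_graphBall_of_mem_VWin (colVT_spec κ Φ t p D g f c hlip hq hN y).1

/-- **THE COLUMN VERTEX'S DEPTH IS LINEAR IN THE CELL INDEX** (the (C)/(R) binder `hcD` with `cC := cOffS`, `dC := 1`; KGDepth's `D₀`):
`colVT y ∈ B_G(t, Φ.M·cOffS·(|y₀| + |y₁|) + 1)`, under the numeric long clause and `|h_L| ≤ 10·n_L`. [cite: KozmaNitzan2024, §4 Lemma 10 Step IV (pp. 20–21)] -/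
theorem colVT_mem_graphBall_lin (κ : Consts) {V : Type} [DecidableEq V] [Countable V] {G : SimpleGraph V} [G.LocallyFinite] (Φ : PlanarSkeletonFrmQuasi G) (t : V) (p : unitInterval) (D : Skelφ.StepI.DataNS V) (g : ℕ) (f : ℕ) (c : Fin 2 → ℕ) {φ' : V → Site 2} (hlip : Skelφ.Lip G φ') (hq : Skelφ.QStepsN G φ' Φ.M) (hN : EqNumL κ Φ t p D g f)
    (hκ : (hL κ Φ t p D g f).natAbs ≤ 10 * nL κ Φ t p D g f) (y : Site 2) :
    colVT κ Φ t p D g f c hlip hq hN y ∈ graphBall G t (Φ.M * cOffS κ Φ t p D g f * ((y 0).natAbs + (y 1).natAbs) + 1) :=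
  graphBall_mono G t (offNT_le κ Φ t p D g f c hN hκ y) (colVT_mem_graphBall κ Φ t p D g f c hlip hq hN y)

-- GEN-Q (R-2, captain 2026-08-27): `PlanarSkeletonFrmFrom.NegB.qSepGeom_fineA_bT` is not in the used cone of the node top — not ported.

end Col

end NegB

end PlanarSkeletonFrmQuasi

end Summit.CriticalPhenomena.PercolationContinuityZ3.Theorems.Transplant

end
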